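import Summits.PneNP.PneNP.Theorems.NegLimitedHalfWindowDefs
import Summits.PneNP.PneNP.Theorems.NegLimitedAmplifiedWindowAmpBiasDecay
import Mathlib
import HarnessLib

/-!
# Route NegLimited — line `half-window`, stub TB part 1: restrictions of a block set and the restricted bias of
`TRIBES ∘ RM3` (rung F-N1/p3, ROUND-13; item stmt-PneNP-19888 `NegLimited.NeglimitedHalfLogNegationsR`, registered
skeleton `half-window`; card HOME/pnp-ideate-p3/r13/half-window.md, "Hardest stub" = `stub_tribesBiasResponse`)

The independence bookkeeping behind the tribes bias response (the stub itself is in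
`NegLimitedHalfWindowTribesBias.lean`):
* GENERIC RE-INDEXING (`expAbsBiasGen_eq_sum_rgwt`, any finite block set `W`, any combiner `Φ`): the `(S, v)`-sum
  defining `expAbsBiasGen Φ p` is the expectation of `|rgbias Φ ρ|` over restrictions `ρ : W → Option Bool` with the
  product weight `rgwt p ρ = ∏_w leafWt p (ρ w)` — the generic form of the landed `Amp.expAbsBias_eq_sum_rwt` (same
  pushforward `Amp.sum_bw_mul_comp` along the leaf code `Bool × Bool → Option Bool`);
* FACTORISATION of block-product sums (`sum_bw_mul_prod_cols`, `sum_bw_mul_prod_rows` = `Fintype.prod_sum`; the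
  TRIBES-shaped statistic `sum_bw_tribesStat` and its square `sum_bw_tribesStat_sq`; uniform averages over the free
  bits of `B × T` as block-product expectations, `uniform_avg_curry`);
* READ-ONCE COMPOSITION (`rgbias_tribesRM3`): with `W = (Fin m × Fin w) × (Fin d → Fin 3)` and `σ b` the restriction of
  block `b`, the free bits of distinct blocks are independent, so `rgbias (tribesRM3 w m d) ρ = 1 − 2·P₀(σ)`,
  `P₀(σ) = tribesP0 w m d σ = ∏_j (1 − ∏_i (1 + rbias d (σ (j,i)))/2)` (`Pr[RM3_d↾σ_b = 1] = (1 + rbias)/2` by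
  `Amp.rhoBias_eq_rbias`; `sgn ∘ TRIBES = 1 − 2·∏_j(1 − ∏_i [y_{ji}])`).

References: R. O'Donnell, *Hardness amplification within NP*, JCSS 69 (2004), §3 [ODonnell2004]; cell record
HOME/pnp-ideate-p3/ROUND-13.md §2, r13/BLUEPRINT-R2.md §TB.

HONEST FRAMING: elementary finite-sum identities for ONE registered stub of an OPEN rung item; FRONTIER rung F-N1 —
nothing here bears on P vs NP.
-/

set_option linter.dupNamespace false -- `Summit.PneNP.PneNP.…`: summit = sub-problem name (D-0017 single-conjunct layout)

namespace Summit.PneNP.PneNP.Theorems.NegLimitedHalfWindow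

open Finset
open Summit.PneNP.PneNP.Theorems.NegLimitedAmplifiedWindow
  (Restr leafWt rwt rbias rmoment qMoment biasSeq recMaj3 sum_rwt rwt_nonneg rmoment_odd qMoment_eq_biasSeq sum_leafWt)
open Summit.PneNP.PneNP.Theorems.NegLimitedAmplifiedWindow.Amp
  (bw cbias sgn indicEquiv leafCode leafCodeWt sum_leafCodeWt_fiber sum_bw_mul_comp sum_bw_eq_prod bw_nonneg
    rhoBias rhoBias_eq_rbias)

/-! ## Generic layer: restrictions of an arbitrary block set `W` -/

section Generic

variable {W : Type} [Fintype W] [DecidableEq W]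

/-- The bias `Pr_z[Φ = 1] − Pr_z[Φ = 0]` of the combiner `Φ` under the restriction `ρ : W → Option Bool`
(`none` = free coordinate, averaged over a fair bit; `some b` = fixed to `b`). -/
noncomputable def rgbias (Φ : (W → Bool) → Bool) (ρ : W → Option Bool) : ℝ :=
  ((2 : ℝ) ^ Fintype.card W)⁻¹ * ∑ z : W → Bool, sgn (Φ fun w => (ρ w).getD (z w))

/-- The weight of a restriction under the `p`-random restriction with fair fixed bits: `∏_w leafWt p (ρ w)`
(`p` per free coordinate, `(1−p)/2` per fixed value). -/
noncomputable def rgwt (p : ℝ) (ρ : W → Option Bool) : ℝ := ∏ w, leafWt p (ρ w)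

/-- **Re-indexing** (generic form of `Amp.expAbsBias_eq_sum_rwt`): `expAbsBiasGen Φ p` is the `rgwt p`-expectation of
`|rgbias Φ|` (the map `(S, v) ↦ ρ` is `2^{|S|}`-to-one and the weights of a fibre add up to `rgwt p ρ`). -/
theorem expAbsBiasGen_eq_sum_rgwt (Φ : (W → Bool) → Bool) (p : ℝ) :
    expAbsBiasGen Φ p = ∑ ρ : W → Option Bool, rgwt p ρ * |rgbias Φ ρ| := by
  classical
  unfold expAbsBiasGen
  -- Step 1: sets `S` as indicator functions, then pair up `(χ, v)` into `c : W → Bool × Bool`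
  rw [← Fintype.sum_equiv (indicEquiv W) (fun χ => ∑ v : W → Bool,
      (p / 2) ^ (indicEquiv _ χ).card * ((1 - p) / 2) ^ (Fintype.card W - (indicEquiv _ χ).card) *
        |cbias Φ (indicEquiv _ χ) v|) _ (fun χ => rfl)]
  rw [← Fintype.sum_prod_type']
  rw [← Fintype.sum_equiv (Equiv.arrowProdEquivProdArrow W (fun _ => Bool) (fun _ => Bool))
      (fun c => (p / 2) ^ (indicEquiv _ (fun w => (c w).1)).card *
        ((1 - p) / 2) ^ (Fintype.card W - (indicEquiv _ (fun w => (c w).1)).card) *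
          |cbias Φ (indicEquiv _ (fun w => (c w).1)) (fun w => (c w).2)|) _ (fun c => rfl)]
  -- Step 2: identify the summand with `bw leafCodeWt c * |rgbias Φ (leafCode ∘ c)|`
  have hsummand : ∀ c : W → Bool × Bool,
      (p / 2) ^ (indicEquiv _ (fun w => (c w).1)).card *
        ((1 - p) / 2) ^ (Fintype.card W - (indicEquiv _ (fun w => (c w).1)).card) *
          |cbias Φ (indicEquiv _ (fun w => (c w).1)) (fun w => (c w).2)| =
      bw (fun _ => leafCodeWt p) c * |rgbias Φ (fun w => leafCode (c w))| := by
    intro c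
    have hS : ∀ w, w ∈ indicEquiv _ (fun w => (c w).1) ↔ (c w).1 = true := fun w => by
      simp [indicEquiv]
    congr 1
    · -- the weight
      unfold bw leafCodeWt
      rw [Finset.prod_ite, Finset.prod_const, Finset.prod_const]
      have hc1 : (univ.filter fun w : W => (c w).1 = true) = indicEquiv _ (fun w => (c w).1) := by
        ext w; simp [indicEquiv]
      have hc2 : (univ.filter fun w : W => ¬(c w).1 = true).card =
          Fintype.card W - (indicEquiv _ (fun w => (c w).1)).card := by
        have h := Finset.card_filter_add_card_filter_not (s := (univ : Finset W)) (fun w => (c w).1 = true)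
        rw [Finset.card_univ, hc1] at h
        omega
      rw [hc1, hc2]
    · -- the bias
      unfold cbias rgbias
      congr 2
      refine Finset.sum_congr rfl fun z _ => ?_
      congr 2
      funext w
      simp only [leafCode, hS]
      split_ifs <;> rfl
  rw [Finset.sum_congr rfl fun c _ => hsummand c]
  have key := sum_bw_mul_comp (fun _ : W => leafCodeWt p) leafCode (fun ρ : W → Option Bool => |rgbias Φ ρ|)
  beta_reduce at key
  rw [key]
  refine Finset.sum_congr rfl fun ρ _ => ?_
  unfold rgwt
  congr 1
  exact Finset.prod_congr rfl fun w _ => sum_leafCodeWt_fiber p (ρ w)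

end Generic

/-! ## Independence bookkeeping: block-product sums factorise -/

section Factorise

variable {I J X : Type} [Fintype I] [DecidableEq I] [Fintype J] [DecidableEq J] [Fintype X]

/-- One level: `Σ_τ (∏_i μ_i(τ_i))·∏_i f_i(τ_i) = ∏_i Σ_x μ_i(x) f_i(x)` (`Fintype.prod_sum`). -/
theorem sum_bw_mul_prod_cols (μ : I → X → ℝ) (f : I → X → ℝ) :
    ∑ τ : I → X, bw μ τ * ∏ i, f i (τ i) = ∏ i, ∑ x, μ i x * f i x := by
  classical
  rw [Fintype.prod_sum]
  refine Finset.sum_congr rfl fun τ _ => ?_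
  unfold bw
  rw [← Finset.prod_mul_distrib]

/-- Two levels: for a block weight `ν` and row statistics `F_j` of the row restrictions,
`Σ_{σ : J × I → X} (∏_b ν(σ_b))·∏_j F_j(σ(j,·)) = ∏_j Σ_{τ : I → X} (∏_i ν(τ_i))·F_j(τ)`. -/
theorem sum_bw_mul_prod_rows (ν : X → ℝ) (F : J → (I → X) → ℝ) :
    ∑ σ : J × I → X, bw (fun _ => ν) σ * ∏ j, F j (fun i => σ (j, i)) =
      ∏ j, ∑ τ : I → X, bw (fun _ => ν) τ * F j τ := by
  classical
  rw [Fintype.prod_sum]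
  rw [← Fintype.sum_equiv (Equiv.curry J I X).symm (fun s : J → I → X =>
      ∏ j, (bw (fun _ => ν) (s j) * F j (s j))) _ (fun s => ?_)]
  show ∏ j, bw (fun _ => ν) (s j) * F j (s j) =
    bw (fun _ => ν) (Function.uncurry s) * ∏ j, F j (fun i => Function.uncurry s (j, i))
  rw [Finset.prod_mul_distrib]
  congr 1
  unfold bw
  exact (Fintype.prod_prod_type' (fun j i => ν (s j i))).symm

/-- Total block-product weight of a probability block weight is `1`. -/
theorem sum_bw_const_eq_one {ν : X → ℝ} (hν : ∑ x, ν x = 1) : ∑ τ : I → X, bw (fun _ : I => ν) τ = 1 := by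
  rw [sum_bw_eq_prod]
  simp [hν]


/-- The TRIBES-shaped statistic factorises: for a probability block weight `ν` and per-block functions `f j i`,
`Σ_Z (∏_b ν(Z_b))·∏_j (1 − ∏_i f_{ji}(Z_{ji})) = ∏_j (1 − ∏_i Σ_y ν(y) f_{ji}(y))`. -/
theorem sum_bw_tribesStat (ν : X → ℝ) (hν : ∑ y, ν y = 1) (f : J → I → X → ℝ) :
    ∑ Z : J × I → X, bw (fun _ => ν) Z * ∏ j, (1 - ∏ i, f j i (Z (j, i))) =
      ∏ j, (1 - ∏ i, ∑ y, ν y * f j i y) := by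
  classical
  refine (sum_bw_mul_prod_rows ν (fun j τ => 1 - ∏ i, f j i (τ i))).trans ?_
  refine Finset.prod_congr rfl fun j _ => ?_
  have hc : ∑ τ : I → X, bw (fun _ : I => ν) τ * ∏ i, f j i (τ i) = ∏ i, ∑ y, ν y * f j i y :=
    sum_bw_mul_prod_cols (fun _ : I => ν) (f j)
  have h1 : ∑ τ : I → X, bw (fun _ : I => ν) τ = 1 := sum_bw_const_eq_one hν
  calc ∑ τ : I → X, bw (fun _ : I => ν) τ * (1 - ∏ i, f j i (τ i))
      = ∑ τ : I → X, (bw (fun _ : I => ν) τ - bw (fun _ : I => ν) τ * ∏ i, f j i (τ i)) :=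
        Finset.sum_congr rfl fun τ _ => by ring
    _ = 1 - ∏ i, ∑ y, ν y * f j i y := by rw [Finset.sum_sub_distrib, h1, hc]

/-- The SQUARED TRIBES-shaped statistic factorises:
`Σ_Z (∏_b ν(Z_b))·(∏_j (1 − ∏_i f_{ji}(Z_{ji})))² = ∏_j (1 − 2·∏_i E f_{ji} + ∏_i E f_{ji}²)`. -/
theorem sum_bw_tribesStat_sq (ν : X → ℝ) (hν : ∑ y, ν y = 1) (f : J → I → X → ℝ) :
    ∑ Z : J × I → X, bw (fun _ => ν) Z * (∏ j, (1 - ∏ i, f j i (Z (j, i)))) ^ 2 =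
      ∏ j, (1 - 2 * ∏ i, ∑ y, ν y * f j i y + ∏ i, ∑ y, ν y * f j i y ^ 2) := by
  classical
  have hsq : ∀ Z : J × I → X, bw (fun _ => ν) Z * (∏ j, (1 - ∏ i, f j i (Z (j, i)))) ^ 2 =
      bw (fun _ => ν) Z * ∏ j, (1 - ∏ i, f j i (Z (j, i))) ^ 2 := fun Z => by rw [Finset.prod_pow]
  rw [Finset.sum_congr rfl fun Z _ => hsq Z]
  refine (sum_bw_mul_prod_rows ν (fun j τ => (1 - ∏ i, f j i (τ i)) ^ 2)).trans ?_
  refine Finset.prod_congr rfl fun j _ => ?_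
  have hc : ∑ τ : I → X, bw (fun _ : I => ν) τ * ∏ i, f j i (τ i) = ∏ i, ∑ y, ν y * f j i y :=
    sum_bw_mul_prod_cols (fun _ : I => ν) (f j)
  have hc2 : ∑ τ : I → X, bw (fun _ : I => ν) τ * ∏ i, f j i (τ i) ^ 2 = ∏ i, ∑ y, ν y * f j i y ^ 2 :=
    sum_bw_mul_prod_cols (fun _ : I => ν) (fun i y => f j i y ^ 2)
  have h1 : ∑ τ : I → X, bw (fun _ : I => ν) τ = 1 := sum_bw_const_eq_one hν
  calc ∑ τ : I → X, bw (fun _ : I => ν) τ * (1 - ∏ i, f j i (τ i)) ^ 2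
      = ∑ τ : I → X, (bw (fun _ : I => ν) τ - 2 * (bw (fun _ : I => ν) τ * ∏ i, f j i (τ i)) +
          bw (fun _ : I => ν) τ * ∏ i, f j i (τ i) ^ 2) :=
        Finset.sum_congr rfl fun τ _ => by rw [Finset.prod_pow]; ring
    _ = 1 - 2 * ∏ i, ∑ y, ν y * f j i y + ∏ i, ∑ y, ν y * f j i y ^ 2 := by
        rw [Finset.sum_add_distrib, Finset.sum_sub_distrib, ← Finset.mul_sum, h1, hc, hc2]

/-- A uniform average over the free bits of `B × T` is a block-product expectation with the constant block weight
`2^{-|T|}` on the curried bits. -/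
theorem uniform_avg_curry {B T : Type} [Fintype B] [DecidableEq B] [Fintype T] [DecidableEq T]
    (G : (B → T → Bool) → ℝ) :
    ((2 : ℝ) ^ Fintype.card (B × T))⁻¹ * ∑ z : B × T → Bool, G (fun b t => z (b, t)) =
      ∑ Z : B → T → Bool, bw (fun (_ : B) (_ : T → Bool) => ((2 : ℝ) ^ Fintype.card T)⁻¹) Z * G Z := by
  classical
  rw [← Fintype.sum_equiv (Equiv.curry B T Bool).symm (fun Z : B → T → Bool => G Z) _ (fun Z => rfl)]
  rw [Finset.mul_sum]
  refine Finset.sum_congr rfl fun Z _ => ?_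
  congr 1
  simp only [bw, Finset.prod_const, Finset.card_univ]
  rw [Fintype.card_prod, pow_mul', inv_pow]

/-- The constant block weight `2^{-|T|}` is a probability weight on `T → Bool`. -/
theorem sum_inv_two_pow_card (T : Type) [Fintype T] [DecidableEq T] :
    ∑ _ζ : T → Bool, ((2 : ℝ) ^ Fintype.card T)⁻¹ = 1 := by
  rw [Finset.sum_const, Finset.card_univ, nsmul_eq_mul]
  have h : (Fintype.card (T → Bool) : ℝ) = (2 : ℝ) ^ Fintype.card T := by
    rw [Fintype.card_fun, Fintype.card_bool]; push_cast; rfl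
  rw [h, mul_inv_cancel₀ (by positivity)]

end Factorise

/-! ## The bias of `TRIBES ∘ RM3` under a block restriction -/

/-- `[b] = (1 + sgn b)/2` as a real number. -/
theorem ite_eq_sgn (b : Bool) : (if b then (1 : ℝ) else 0) = (1 + sgn b) / 2 := by
  cases b <;> norm_num [sgn]

/-- `sgn (TRIBES y) = 1 − 2·∏_j (1 − ∏_i [y (j,i)])`. -/
theorem sgn_tribes (w m : ℕ) (y : Fin m × Fin w → Bool) :
    sgn (tribes w m y) = 1 - 2 * ∏ j : Fin m, (1 - ∏ i : Fin w, if y (j, i) then (1 : ℝ) else 0) := by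
  unfold tribes
  by_cases h : ∃ j : Fin m, ∀ i : Fin w, y (j, i) = true
  · rw [decide_eq_true h]
    obtain ⟨j, hj⟩ := h
    rw [Finset.prod_eq_zero (Finset.mem_univ j)]
    · norm_num [sgn]
    · rw [Finset.prod_eq_one fun i _ => by simp [hj i]]
      ring
  · rw [decide_eq_false h]
    simp only [not_exists, not_forall] at h
    rw [Finset.prod_eq_one]
    · norm_num [sgn]
    · intro j _
      obtain ⟨i, hi⟩ := h j
      rw [Finset.prod_eq_zero (Finset.mem_univ i)]
      · ring
      · simp [hi]

/-- `Pr_z[RM3_d↾ρ = 1] = (1 + rbias d ρ)/2`: the number of accepting free-bit settings, normalised. -/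
theorem avg_ite_recMaj3 (d : ℕ) (ρ : Restr d) :
    ∑ ζ : (Fin d → Fin 3) → Bool, ((2 : ℝ) ^ Fintype.card (Fin d → Fin 3))⁻¹ *
        (if recMaj3 d (fun u => (ρ u).getD (ζ u)) then (1 : ℝ) else 0) = (1 + rbias d ρ) / 2 := by
  have hT : Fintype.card (Fin d → Fin 3) = 3 ^ d := by simp
  rw [hT, ← rhoBias_eq_rbias]
  unfold rhoBias
  simp_rw [ite_eq_sgn]
  rw [← Finset.mul_sum, ← Finset.sum_div, Finset.sum_add_distrib, Finset.sum_const, Finset.card_univ,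
    nsmul_eq_mul, mul_one]
  have hcard : (Fintype.card ((Fin d → Fin 3) → Bool) : ℝ) = (2 : ℝ) ^ 3 ^ d := by simp
  rw [hcard, mul_div_assoc', mul_add, inv_mul_cancel₀ (by positivity)]

/-- The TRIBES rejection statistic `P₀(σ) = ∏_j (1 − ∏_i (1 + b_{ji})/2)`, `b = rbias d ∘ σ`. -/
noncomputable def tribesP0 (w m d : ℕ) (σ : Fin m × Fin w → Restr d) : ℝ :=
  ∏ j : Fin m, (1 - ∏ i : Fin w, (1 + rbias d (σ (j, i))) / 2)

/-- The weight of a restriction of `(Fin m × Fin w) × (Fin d → Fin 3)` is the block product of the `rwt`-weights of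
its block restrictions. -/
theorem rgwt_uncurry (p : ℝ) {m w d : ℕ} (σ : Fin m × Fin w → Restr d) :
    rgwt p (Function.uncurry σ) = bw (fun _ : Fin m × Fin w => rwt p) σ := by
  simp only [rgwt, bw, rwt]
  exact Fintype.prod_prod_type' (fun b u => leafWt p (σ b u))

/-- **Read-once composition**: the restricted bias of `TRIBES_{w,m} ∘ RM3_d` is `1 − 2·P₀(σ)`. -/
theorem rgbias_tribesRM3 (w m d : ℕ) (σ : Fin m × Fin w → Restr d) :
    rgbias (tribesRM3 w m d) (Function.uncurry σ) = 1 - 2 * tribesP0 w m d σ := by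
  classical
  have hν := sum_inv_two_pow_card (Fin d → Fin 3)
  -- the uniform average over the free bits as a block-product expectation of the TRIBES statistic
  have h1 : rgbias (tribesRM3 w m d) (Function.uncurry σ) =
      ∑ Z : Fin m × Fin w → (Fin d → Fin 3) → Bool,
        bw (fun (_ : Fin m × Fin w) (_ : (Fin d → Fin 3) → Bool) => ((2 : ℝ) ^ Fintype.card (Fin d → Fin 3))⁻¹) Z *
          (1 - 2 * ∏ j : Fin m, (1 - ∏ i : Fin w,
            if recMaj3 d (fun u => (σ (j, i) u).getD (Z (j, i) u)) then (1 : ℝ) else 0)) := by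
    unfold rgbias
    simp only [tribesRM3, sgn_tribes]
    exact uniform_avg_curry (fun Z : Fin m × Fin w → (Fin d → Fin 3) → Bool =>
      1 - 2 * ∏ j : Fin m, (1 - ∏ i : Fin w,
        if recMaj3 d (fun u => (σ (j, i) u).getD (Z (j, i) u)) then (1 : ℝ) else 0))
  -- factorise the statistic
  have h2 := sum_bw_tribesStat (fun _ : (Fin d → Fin 3) → Bool => ((2 : ℝ) ^ Fintype.card (Fin d → Fin 3))⁻¹) hν
    (fun (j : Fin m) (i : Fin w) (ζ : (Fin d → Fin 3) → Bool) =>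
      if recMaj3 d (fun u => (σ (j, i) u).getD (ζ u)) then (1 : ℝ) else 0)
  have h0 : ∑ Z : Fin m × Fin w → (Fin d → Fin 3) → Bool,
      bw (fun (_ : Fin m × Fin w) (_ : (Fin d → Fin 3) → Bool) => ((2 : ℝ) ^ Fintype.card (Fin d → Fin 3))⁻¹) Z = 1 :=
    sum_bw_const_eq_one hν
  rw [h1]
  calc ∑ Z : Fin m × Fin w → (Fin d → Fin 3) → Bool,
        bw (fun (_ : Fin m × Fin w) (_ : (Fin d → Fin 3) → Bool) => ((2 : ℝ) ^ Fintype.card (Fin d → Fin 3))⁻¹) Z *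
          (1 - 2 * ∏ j : Fin m, (1 - ∏ i : Fin w,
            if recMaj3 d (fun u => (σ (j, i) u).getD (Z (j, i) u)) then (1 : ℝ) else 0))
      = ∑ Z : Fin m × Fin w → (Fin d → Fin 3) → Bool,
          (bw (fun (_ : Fin m × Fin w) (_ : (Fin d → Fin 3) → Bool) => ((2 : ℝ) ^ Fintype.card (Fin d → Fin 3))⁻¹) Z -
            2 * (bw (fun (_ : Fin m × Fin w) (_ : (Fin d → Fin 3) → Bool) =>
              ((2 : ℝ) ^ Fintype.card (Fin d → Fin 3))⁻¹) Z *
              ∏ j : Fin m, (1 - ∏ i : Fin w,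
                if recMaj3 d (fun u => (σ (j, i) u).getD (Z (j, i) u)) then (1 : ℝ) else 0))) :=
        Finset.sum_congr rfl fun Z _ => by ring
    _ = 1 - 2 * ∏ j : Fin m, (1 - ∏ i : Fin w, ∑ ζ : (Fin d → Fin 3) → Bool,
          ((2 : ℝ) ^ Fintype.card (Fin d → Fin 3))⁻¹ *
            (if recMaj3 d (fun u => (σ (j, i) u).getD (ζ u)) then (1 : ℝ) else 0)) := by
        rw [Finset.sum_sub_distrib, ← Finset.mul_sum, h0, h2]
    _ = 1 - 2 * tribesP0 w m d σ := by
        unfold tribesP0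
        simp only [avg_ite_recMaj3]

end Summit.PneNP.PneNP.Theorems.NegLimitedHalfWindow
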